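import Literature.NumberTheory.LFunctions.DivisorCombFactorisation
import HarnessLib

/-!
# The `ζ_M`-mollified coefficients of a complex resonator: `a = α ⋆ (k^{-1/2} 1_{k ≤ M})`

Topic `Literature/NumberTheory/LFunctions`. The complex-coefficient versions of the bookkeeping
identities of `Literature/NumberTheory/LFunctions/DivisorCombFactorisation.lean` (which treats a
real resonator). For a finitely supported complex resonator `α : ℕ → ℂ` (`α_ℓ = 0` for `ℓ > L`;
complex designs arise e.g. from Riesz products rotated by phases `e^{iφ}`) and a length `M`, the
mollified coefficients are `a_m = ∑_{k ∣ m, k ≤ M} α(m/k) k^{-1/2}` (`m ≤ LM`), and: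

* `Literature.NumberTheory.LFunctions.sum_divisorConv_mul_eq_complex` — for every `F : ℕ → ℂ`,
  `∑_{m ≤ LM} a_m F(m) = ∑_{ℓ ≤ L} ∑_{k ≤ M} α_ℓ k^{-1/2} F(ℓ k)`;
* `Literature.NumberTheory.LFunctions.sum_divisorConv_mul_cpow_eq_complex` — `A(s) = Ã(s) ζ_M(1-s)`:
  `∑_m a_m m^{s-1/2} = (∑_{ℓ ≤ L} α_ℓ ℓ^{s-1/2}) (∑_{k ≤ M} k^{-(1-s)})`;
* `Literature.NumberTheory.LFunctions.norm_sum_divisorConv_mul_cpow_le_complex` — for `Re s ≤ 1`,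
  `‖∑_m a_m m^{s-1/2}‖ ≤ (∑_{ℓ ≤ L} ‖α_ℓ‖ √ℓ) ‖∑_{k ≤ M} k^{-(1-s)}‖`;
* `Literature.NumberTheory.LFunctions.re_divisorConv`, `im_divisorConv` — the real and imaginary
  parts of `a_m` are the mollified coefficients of `Re α`, `Im α`.

The proofs are those of the real case verbatim. Everything is proved; no named facts.

## References

* K. Soundararajan, *Extreme values of zeta and L-functions*, Math. Ann. 342 (2008), §2.
-/

noncomputable section

open Complex Finset
open scoped Real

namespace Literature.NumberTheory.LFunctions

/-- **Rearrangement of the mollified comb (complex resonator)**: for `α : ℕ → ℂ` vanishing above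
`L` and any `F`,
`∑_{m ≤ LM} (∑_{k ∣ m, k ≤ M} α(m/k)/√k) F(m) = ∑_{ℓ=1}^{L} ∑_{k=1}^{M} (α_ℓ/√k) F(ℓk)`.
[folklore] -/
theorem sum_divisorConv_mul_eq_complex {α : ℕ → ℂ} {L : ℕ} (hα : ∀ m, L < m → α m = 0) (M : ℕ)
    (F : ℕ → ℂ) :
    ∑ m ∈ Finset.range (L * M + 1),
        (∑ k ∈ (Nat.divisors m).filter (· ≤ M), α (m / k) / (Real.sqrt k : ℂ)) * F m
      = ∑ ℓ ∈ Finset.Icc 1 L, ∑ k ∈ Finset.Icc 1 M, α ℓ / (Real.sqrt k : ℂ) * F (ℓ * k) := by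
  classical
  -- expand the left side as a sum over the pairs `⟨m, k⟩`
  have hL : ∑ m ∈ Finset.range (L * M + 1),
      (∑ k ∈ (Nat.divisors m).filter (· ≤ M), α (m / k) / (Real.sqrt k : ℂ)) * F m
      = ∑ p ∈ (Finset.range (L * M + 1)).sigma (fun m ↦ (Nat.divisors m).filter (· ≤ M)),
          α (p.1 / p.2) / (Real.sqrt p.2 : ℂ) * F p.1 := by
    rw [Finset.sum_sigma]
    refine Finset.sum_congr rfl fun m _ ↦ ?_
    rw [Finset.sum_mul]
  -- and the right side as a sum over the pairs `(ℓ, k)`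
  have hR : ∑ ℓ ∈ Finset.Icc 1 L, ∑ k ∈ Finset.Icc 1 M, α ℓ / (Real.sqrt k : ℂ) * F (ℓ * k)
      = ∑ q ∈ Finset.Icc 1 L ×ˢ Finset.Icc 1 M, α q.1 / (Real.sqrt q.2 : ℂ) * F (q.1 * q.2) := by
    rw [Finset.sum_product]
  rw [hL, hR]
  symm
  -- bijection on the non-zero terms: `(ℓ, k) ↦ ⟨ℓ k, k⟩`
  refine Finset.sum_bij_ne_zero (fun q _ _ ↦ (⟨q.1 * q.2, q.2⟩ : (_ : ℕ) × ℕ)) ?_ ?_ ?_ ?_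
  · -- maps into
    rintro ⟨ℓ, k⟩ hq _
    simp only [Finset.mem_product, Finset.mem_Icc] at hq
    obtain ⟨⟨hℓ1, hℓL⟩, hk1, hkM⟩ := hq
    simp only [Finset.mem_sigma, Finset.mem_range, Finset.mem_filter, Nat.mem_divisors]
    refine ⟨?_, ⟨Dvd.intro_left ℓ rfl, ?_⟩, hkM⟩
    · have : ℓ * k ≤ L * M := Nat.mul_le_mul hℓL hkM
      omega
    · exact Nat.mul_ne_zero (by omega) (by omega)
  · -- injective
    rintro ⟨ℓ₁, k₁⟩ hq₁ _ ⟨ℓ₂, k₂⟩ hq₂ _ h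
    simp only [Sigma.mk.inj_iff, heq_eq_eq] at h
    obtain ⟨h1, rfl⟩ := h
    simp only [Finset.mem_product, Finset.mem_Icc] at hq₁
    have hk : 0 < k₁ := by omega
    have : ℓ₁ = ℓ₂ := Nat.eq_of_mul_eq_mul_right hk h1
    subst this
    rfl
  · -- surjective onto the non-zero terms
    rintro ⟨m, k⟩ hp hne
    simp only [Finset.mem_sigma, Finset.mem_range, Finset.mem_filter, Nat.mem_divisors] at hp
    obtain ⟨hm, ⟨hkm, hm0⟩, hkM⟩ := hp
    have hk0 : 0 < k := Nat.pos_of_dvd_of_pos hkm (Nat.pos_of_ne_zero hm0)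
    have hmk : m / k * k = m := Nat.div_mul_cancel hkm
    have hℓpos : 1 ≤ m / k := by
      rcases Nat.eq_zero_or_pos (m / k) with h | h
      · rw [h, zero_mul] at hmk; exact absurd hmk.symm hm0
      · exact h
    have hℓL : m / k ≤ L := by
      by_contra hlt
      push Not at hlt
      apply hne
      simp [hα _ hlt]
    refine ⟨(m / k, k), ?_, ?_, ?_⟩
    · simp only [Finset.mem_product, Finset.mem_Icc]
      exact ⟨⟨hℓpos, hℓL⟩, hk0, hkM⟩
    · simpa [hmk] using hne
    · simp [hmk]
  · -- the terms agree
    rintro ⟨ℓ, k⟩ hq _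
    simp only [Finset.mem_product, Finset.mem_Icc] at hq
    have hk : 0 < k := by omega
    simp [Nat.mul_div_cancel ℓ hk]

/-- `1/√k = k^{-1/2}` as a complex power (`k ≥ 1`). [folklore] -/
theorem inv_ofReal_sqrt_natCast {k : ℕ} (hk : 0 < k) :
    ((Real.sqrt k : ℝ) : ℂ)⁻¹ = (k : ℂ) ^ (-(1 / 2 : ℂ)) := by
  have hkR : (0 : ℝ) ≤ k := Nat.cast_nonneg k
  have hk0 : (k : ℂ) ≠ 0 := Nat.cast_ne_zero.2 hk.ne'
  rw [Real.sqrt_eq_rpow, ← Complex.ofReal_inv, ← Real.rpow_neg hkR, Complex.ofReal_cpow hkR]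
  push_cast
  ring_nf

/-- **`A(s) = Ã(s) ζ_M(1-s)` (complex resonator)**: with `a_m = ∑_{k ∣ m, k ≤ M} α(m/k)/√k`
(`α : ℕ → ℂ` vanishing above `L`),
`∑_{m ≤ LM} a_m m^{s-1/2} = (∑_{ℓ=1}^{L} α_ℓ ℓ^{s-1/2}) (∑_{k=1}^{M} k^{-(1-s)})`. [folklore] -/
theorem sum_divisorConv_mul_cpow_eq_complex {α : ℕ → ℂ} {L : ℕ} (hα : ∀ m, L < m → α m = 0)
    (M : ℕ) (s : ℂ) :
    ∑ m ∈ Finset.range (L * M + 1),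
        (∑ k ∈ (Nat.divisors m).filter (· ≤ M), α (m / k) / (Real.sqrt k : ℂ)) *
          (m : ℂ) ^ (s - 1 / 2)
      = (∑ ℓ ∈ Finset.Icc 1 L, α ℓ * (ℓ : ℂ) ^ (s - 1 / 2)) *
          (∑ k ∈ Finset.Icc 1 M, (k : ℂ) ^ (-(1 - s))) := by
  rw [sum_divisorConv_mul_eq_complex hα M (fun m ↦ (m : ℂ) ^ (s - 1 / 2)), Finset.sum_mul_sum]
  refine Finset.sum_congr rfl fun ℓ _ ↦ Finset.sum_congr rfl fun k hk ↦ ?_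
  have hk : 0 < k := (Finset.mem_Icc.1 hk).1
  have hk0 : (k : ℂ) ≠ 0 := Nat.cast_ne_zero.2 hk.ne'
  rw [div_eq_mul_inv, inv_ofReal_sqrt_natCast hk, Nat.cast_mul, Complex.natCast_mul_natCast_cpow]
  have hpow : (k : ℂ) ^ (-(1 / 2 : ℂ)) * (k : ℂ) ^ (s - 1 / 2) = (k : ℂ) ^ (-(1 - s)) := by
    rw [← Complex.cpow_add _ _ hk0]; congr 1; ring
  calc α ℓ * (k : ℂ) ^ (-(1 / 2 : ℂ)) * ((ℓ : ℂ) ^ (s - 1 / 2) * (k : ℂ) ^ (s - 1 / 2))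
      = α ℓ * (ℓ : ℂ) ^ (s - 1 / 2) * ((k : ℂ) ^ (-(1 / 2 : ℂ)) * (k : ℂ) ^ (s - 1 / 2)) := by
        ring
    _ = α ℓ * (ℓ : ℂ) ^ (s - 1 / 2) * (k : ℂ) ^ (-(1 - s)) := by rw [hpow]

/-- **The resonator factor is bounded (complex resonator)**: for `Re s ≤ 1`,
`‖∑_{ℓ=1}^{L} α_ℓ ℓ^{s-1/2}‖ ≤ ∑_{ℓ=1}^{L} ‖α_ℓ‖ √ℓ`. [folklore] -/
theorem norm_sum_resonator_cpow_le_complex (α : ℕ → ℂ) (L : ℕ) {s : ℂ} (hs : s.re ≤ 1) :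
    ‖∑ ℓ ∈ Finset.Icc 1 L, α ℓ * (ℓ : ℂ) ^ (s - 1 / 2)‖
      ≤ ∑ ℓ ∈ Finset.Icc 1 L, ‖α ℓ‖ * Real.sqrt ℓ := by
  refine (norm_sum_le _ _).trans (Finset.sum_le_sum fun ℓ hℓ ↦ ?_)
  have hℓ1 : 1 ≤ ℓ := (Finset.mem_Icc.1 hℓ).1
  have hℓR : (1 : ℝ) ≤ ℓ := by exact_mod_cast hℓ1
  rw [norm_mul, Complex.norm_natCast_cpow_of_pos (by omega)]
  refine mul_le_mul_of_nonneg_left ?_ (norm_nonneg _)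
  rw [Real.sqrt_eq_rpow]
  refine Real.rpow_le_rpow_of_exponent_le hℓR ?_
  simp only [sub_re, one_div]
  norm_num
  linarith

/-- **`|A(s)| ≤ C_α |ζ_M(1-s)|` (complex resonator)**: for `Re s ≤ 1`,
`‖∑_{m ≤ LM} a_m m^{s-1/2}‖ ≤ (∑_{ℓ ≤ L} ‖α_ℓ‖ √ℓ) ‖∑_{k ≤ M} k^{-(1-s)}‖`. [folklore] -/
theorem norm_sum_divisorConv_mul_cpow_le_complex {α : ℕ → ℂ} {L : ℕ}
    (hα : ∀ m, L < m → α m = 0) (M : ℕ) {s : ℂ} (hs : s.re ≤ 1) :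
    ‖∑ m ∈ Finset.range (L * M + 1),
        (∑ k ∈ (Nat.divisors m).filter (· ≤ M), α (m / k) / (Real.sqrt k : ℂ)) *
          (m : ℂ) ^ (s - 1 / 2)‖
      ≤ (∑ ℓ ∈ Finset.Icc 1 L, ‖α ℓ‖ * Real.sqrt ℓ) *
          ‖∑ k ∈ Finset.Icc 1 M, (k : ℂ) ^ (-(1 - s))‖ := by
  rw [sum_divisorConv_mul_cpow_eq_complex hα M s, norm_mul]
  exact mul_le_mul_of_nonneg_right (norm_sum_resonator_cpow_le_complex α L hs) (norm_nonneg _)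

/-- The real part of the complex mollified coefficient is the mollified coefficient of `Re α`:
`Re ∑_{k ∣ m, k ≤ M} α(m/k)/√k = ∑_{k ∣ m, k ≤ M} Re α(m/k)/√k`. [folklore] -/
theorem re_divisorConv (α : ℕ → ℂ) (m M : ℕ) :
    (∑ k ∈ (Nat.divisors m).filter (· ≤ M), α (m / k) / (Real.sqrt k : ℂ)).re
      = ∑ k ∈ (Nat.divisors m).filter (· ≤ M), (α (m / k)).re / Real.sqrt k := by
  rw [Complex.re_sum]
  simp only [Complex.div_ofReal_re]

/-- The imaginary part of the complex mollified coefficient is the mollified coefficient of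
`Im α`: `Im ∑_{k ∣ m, k ≤ M} α(m/k)/√k = ∑_{k ∣ m, k ≤ M} Im α(m/k)/√k`. [folklore] -/
theorem im_divisorConv (α : ℕ → ℂ) (m M : ℕ) :
    (∑ k ∈ (Nat.divisors m).filter (· ≤ M), α (m / k) / (Real.sqrt k : ℂ)).im
      = ∑ k ∈ (Nat.divisors m).filter (· ≤ M), (α (m / k)).im / Real.sqrt k := by
  rw [Complex.im_sum]
  simp only [Complex.div_ofReal_im]

/-- The complex mollified coefficient of a real resonator cast to `ℂ` is the cast of the real
mollified coefficient. [folklore] -/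
theorem divisorConv_ofReal (α : ℕ → ℝ) (m M : ℕ) :
    (∑ k ∈ (Nat.divisors m).filter (· ≤ M), (α (m / k) : ℂ) / (Real.sqrt k : ℂ))
      = ((∑ k ∈ (Nat.divisors m).filter (· ≤ M), α (m / k) / Real.sqrt k : ℝ) : ℂ) := by
  push_cast
  rfl

end Literature.NumberTheory.LFunctions
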